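import Summits.BirchSwinnertonDyer.BirchSwinnertonDyer.Theorems.ResidualThetaTransportAtTwoSignedMuVanishingAtTwoPlusCuspSpanHeckeKernel
import Summits.BirchSwinnertonDyer.BirchSwinnertonDyer.Theorems.ResidualThetaTransportAtTwoCuspSpanDefs
import HarnessLib

/-!
# Route `ResidualThetaTransportAtTwo`, crux Kμ⁺ `SignedMuVanishingAtTwoPlus` (stmt-BirchSwinnertonDyer-20689),
# line `birth`, stub `stub_flatMuZeroAtTwo`: Theorem (R) stated with the NAMED hypothesis `CuspSpanEvenAtTwo N`

Cell `bsd-wall`, lead `bsd-wall-rtt-p4` g5 (helper; THEOREMS ONLY — no `def`, no `sorry`; BSD is not proved by this). The landed chain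
p592546 / p592862 / p593268 / p595221 spells the curve-free spanning hypothesis (G′)_N inline; the definition file
`…ResidualThetaTransportAtTwoCuspSpanDefs` (p595076) names it `SignedMuAtTwo.CuspSpanEvenAtTwo N` (`@[conjecture]` predicate, `Iff.rfl`
with the inline text). This file restates the consumers BY NAME, so that a planner can file «`CuspSpanEvenAtTwo N` for every odd `N`»
(or per level) as the analytic residue node and cite these theorems as its glue:

* `flatAtTwo_of_cuspSpanEvenAtTwo` — habitat⁺ (`IsNewformOf W f`, `GoodSS W 2`, `a₂(W) = 0`):
  `CuspSpanEvenAtTwo N_W ⟹ 2 ∤ L♭` for every Pollack pair of `f` at `2`;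
* `heckeKernelSpan_of_cuspSpanEvenAtTwo` — `CuspSpanEvenAtTwo N ⟹ (G″)_N` (the minimal `T₂`-kernel form, inline), odd `N`;
* `flatMuZeroAtTwo_of_forall_cuspSpanEvenAtTwo` — `(∀ odd N, CuspSpanEvenAtTwo N) ⟹ FlatMuZeroAtTwo` (registered stub, verbatim);
* `signedMuAnalyticAtTwoPlus_of_abbesUllmo_of_forall_cuspSpanEvenAtTwo` — with Abbes–Ullmo Thm A by name, child 21437
  `SignedMuAnalyticAtTwoPlus`.

References: R. Pollack, Duke Math. J. 118 (2003) Conj. 6.3, Prop. 6.18 [Pollack2003]; A. Abbes, E. Ullmo, Compositio 103 (1996) Thm. A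
[AbbesUllmo1996].
-/

set_option autoImplicit false
set_option linter.dupNamespace false

noncomputable section

open scoped Classical MatrixGroups ModularForm

open CongruenceSubgroup WeierstrassCurve Literature.NumberTheory.EllipticCurves
  Literature.NumberTheory.EllipticCurves.ModularForms Literature.NumberTheory.EllipticCurves.Rank1Residual
  Literature.NumberTheory.IwasawaTheory Summit.BirchSwinnertonDyer.Rank1Residual.Supersingular
  Summit.BirchSwinnertonDyer.BirchSwinnertonDyer.Theses.ResidualThetaTransportAtTwo

namespace Summit.BirchSwinnertonDyer.BirchSwinnertonDyer.Theorems.SignedMuAtTwo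

variable {W : WeierstrassCurve ℚ} [W.IsElliptic] [W.IsGloballyMinimal]

/-- **THEOREM (R) on the habitat⁺, named hypothesis**: `CuspSpanEvenAtTwo N_W` ⟹ FLAT at `(W, f)` for `W` good supersingular at `2`
with `a₂(W) = 0` and its newform `f` (`flatAtTwo_of_cuspSpan` with the `Iff.rfl`-named hypothesis). BSD is not proved by this;
`CuspSpanEvenAtTwo N_W` is a hypothesis (verified numerically at the five smallest habitat⁺ conductors, see the Defs file).
[cite: Pollack2003, Conj. 6.3 and Prop. 6.18] -/
theorem flatAtTwo_of_cuspSpanEvenAtTwo [NeZero (W.conductorNorm ℤ)] {f : CuspForm (Gamma0 (W.conductorNorm ℤ)) 2}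
    (hf : IsNewformOf W f) (hss : GoodSS W 2) (ha : W.frobeniusTrace 2 = 0) (hG : CuspSpanEvenAtTwo (W.conductorNorm ℤ)) :
    ∀ Lplus Lminus : IwasawaAlgebra 2, IsPollackPair f 2 Lplus Lminus → ¬ PowerSeries.C (2 : ℤ_[2]) ∣ Lminus :=
  flatAtTwo_of_cuspSpan hf hss ha hG

/-- **`CuspSpanEvenAtTwo N` ⟹ the minimal `T₂`-kernel hypothesis (G″)_N** (odd `N`; `heckeKernelSpan_of_cuspSpan`).
[cite: LingOesterle1991, Thm. 6 (character form, p = 2)] -/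
theorem heckeKernelSpan_of_cuspSpanEvenAtTwo {N : ℕ} [NeZero N] (h2N : ¬ 2 ∣ N) (hG : CuspSpanEvenAtTwo N) :
    ∀ χ : Gamma0 N → ZMod 2,
      (∀ γ δ : Gamma0 N, χ (γ * δ) = χ γ + χ δ) →
      (∀ γ δ : Gamma0 N, periodFunctional N γ = periodFunctional N δ → χ γ = χ δ) →
      (∀ (γ : Gamma0 N) (δ : Fin 2 → Gamma0 N) (δ' : Gamma0 N),
        (∀ h : CuspForm (Gamma0 N) 2,
          cuspSymbol (heckeT (Gamma0 N) 2 2 h) γ = ∑ j : Fin 2, cuspSymbol h (δ j) + cuspSymbol h δ') →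
        ∑ j : Fin 2, χ (δ j) + χ δ' = 0) →
      (∀ γ : Gamma0 N, (∃ k : ℕ, 1 ≤ k ∧ ((γ : SL(2, ℤ)) 1 1).natAbs = 4 ^ k) → χ γ = 0) →
      ∀ γ : Gamma0 N, χ γ = 0 :=
  heckeKernelSpan_of_cuspSpan h2N hG

/-- **`CuspSpanEvenAtTwo N` for every odd `N` ⟹ the registered stub `FlatMuZeroAtTwo`** of line `birth` (verbatim). BSD is not
proved by this. [cite: Pollack2003, Conj. 6.3 and Prop. 6.18] -/
theorem flatMuZeroAtTwo_of_forall_cuspSpanEvenAtTwo (hG : ∀ (N : ℕ) [NeZero N], ¬ 2 ∣ N → CuspSpanEvenAtTwo N) :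
    ∀ (W : WeierstrassCurve ℚ) [W.IsElliptic] [W.IsGloballyMinimal], ¬ W.HasCM → W.analyticRank = 0 →
      GoodSS W 2 → W.frobeniusTrace 2 = 0 → W.Δ < 0 →
      ∀ [NeZero (W.conductorNorm ℤ)] (f : CuspForm (Gamma0 (W.conductorNorm ℤ)) 2), IsNewformOf W f →
      ∀ (Lplus Lminus : IwasawaAlgebra 2), IsPollackPair f 2 Lplus Lminus → ¬ PowerSeries.C (2 : ℤ_[2]) ∣ Lminus :=
  flatMuZeroAtTwo_of_cuspSpan fun N _ hN ↦ hG N hN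

/-- **`CuspSpanEvenAtTwo N` for every odd `N` ∧ Abbes–Ullmo Thm A (by name) ⟹ the analytic child 21437 `SignedMuAnalyticAtTwoPlus`.**
Conditional on the print fact and on the conjecture-grade predicate; BSD is not proved by this.
[cite: AbbesUllmo1996, Thm. A] [cite: Pollack2003, Conj. 6.3 and Prop. 6.18] -/
theorem signedMuAnalyticAtTwoPlus_of_abbesUllmo_of_forall_cuspSpanEvenAtTwo
    (hAU : abbesUllmo_not_dvd_maninConstant_of_not_dvd_level)
    (hG : ∀ (N : ℕ) [NeZero N], ¬ 2 ∣ N → CuspSpanEvenAtTwo N) : SignedMuAnalyticAtTwoPlus :=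
  signedMuAnalyticAtTwoPlus_of_abbesUllmo_of_cuspSpan hAU fun N _ hN ↦ hG N hN

end Summit.BirchSwinnertonDyer.BirchSwinnertonDyer.Theorems.SignedMuAtTwo

end
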